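import Literature.NumberTheory.LFunctions.WeilExplicitRightEdge
import Mathlib.Analysis.SpecificLimits.Normed
import Mathlib.MeasureTheory.Integral.ExpDecay
import HarnessLib

/-!
# Bombieri's form of the archimedean term of the explicit formula

Sibling of `Literature/NumberTheory/LFunctions/WeilExplicit.lean`; discharges the named fact
`Literature.NumberTheory.LFunctions.weilArchTermBombieri_eq_weilArchTerm`:
for every test function `g`,

  `-(log 4π + γ) g(0) - ∫₀^∞ (e^{t/2}(g(t) + g(-t)) - 2 g(0)) dt/(2 sinh t)`
  `= (1/2π) ∫ ĝ(1/2 + it) Re ψ(1/4 + it/2) dt - g(0) log π`,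

i.e. `weilArchTermBombieri g = weilArchTerm g`. This is E. Bombieri, *Remarks on Weil's quadratic
functional in the theory of prime numbers I*, Rend. Mat. Acc. Lincei (9) 11 (2000), §2, the
"Moreover" clause of the Explicit Formula, eq. (2.8):
`(1/2π) ∫ Re[Γ'/Γ(1/4 + iv/2)] f̃(1/2 + iv) dv
  = -(log 4 + γ) f(1) - ∫₁^∞ {f(x) + f*(x) - (2/x) f(1)} x dx/(x² - 1)`,
transported by `x = e^t`, `f(x) = x^{-1/2} g(log x)` (so `f̃(1/2 + iv) = ĝ(1/2 + iv)`, `f(1) = g(0)`,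
`f + f* = e^{-t/2}(g(t) + g(-t))`, `x dx/(x² - 1) = e^t dt/(2 sinh t)`).

## Proof

We follow Bombieri's own computation (2.5)–(2.8), with absolutely convergent series in place of
his `O(1/N)` bookkeeping. Let `k(t) = g(t) + g(-t)` (`weilSymm g`), `s = 1/2 + iy`, `w = s/2`.

* `Literature/NumberTheory/LFunctions/WeilExplicitRightEdge.lean` already gives
  `weilArchIntegral g = ∫ ½ ψ(w) k̂(s) dy` (`integral_digamma_mul_weilMellin_weilSymm`,
  `integral_digamma_half_mul_weilMellin_shift`).
* The series `ψ(w) + γ = Σₙ (1/(n+1) - 1/(w+n))` (Andrews–Askey–Roy (1.2.13),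
  `Literature.Analysis.SpecialFunctions.Complex.hasSum_one_div_sub_one_div_digamma`; Bombieri
  quotes Whittaker–Watson §12.16) is integrated term by term against `k̂(s)` (dominated
  convergence: the terms are `≤ 4‖w - 1‖‖k̂(s)‖/(n+1)²` and `k̂` decays like `(1 + y²)⁻²`),
  `hasSum_integral_weilMellin_mul_digammaSeries`.
* Each term is a polar integral: `1/(w + n) = 2/(s + 2n)` and
  `∫ k̂(s)/(s + 2n) dy = 2π ∫₀^∞ k(x) e^{-(2n+1/2)x} dx` (Bombieri (2.6),
  `integral_weilMellin_vertical_div_sub`), while `∫ k̂(s) dy = 2π k(0)`; this is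
  `integral_weilMellin_mul_digammaSeriesTerm`, whence `hasSum_weilArchIntegral`:
  `Σₙ (4π g(0)/(n+1) - 4π ∫₀^∞ k(x) e^{-(2n+1/2)x} dx) = 2·weilArchIntegral g + 4πγ g(0)`.
* On Bombieri's side, `1/(2 sinh x) = Σₙ e^{-(2n+1)x}` and dominated convergence on `(0, ∞)`
  (the numerator `e^{x/2}k(x) - k(0)` is `O(x)` at `0`, `hasSum_integral_bombieriTerms`) give
  `∫₀^∞ (e^{x/2}k(x) - k(0)) dx/(2 sinh x) = Σₙ (∫₀^∞ k(x)e^{-(2n+1/2)x} dx - k(0)/(2n+1))`.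
* Finally `Σₙ (2/(2n+1) - 1/(n+1)) = log 4` (`hasSum_two_div_sub_one_div`, the series at
  `w = 1/2` and `ψ(1/2) = -2 log 2 - γ`), which is exactly the `log 4` of (2.8).

Everything here is proved; there are no named facts.

## References

* E. Bombieri, *Remarks on Weil's quadratic functional in the theory of prime numbers I*, Rend.
  Mat. Acc. Lincei (9) 11 (2000), 183–233, §2, eq. (2.5)–(2.8).
* G. E. Andrews, R. Askey, R. Roy, *Special Functions*, CUP 1999, Thm. 1.2.5 (1.2.13).
-/

noncomputable section

open Complex Filter Set MeasureTheory
open scoped Real Topology ContDiff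

namespace Literature.NumberTheory.LFunctions

variable {g k : ℝ → ℂ}

/-! ### Integrability on the critical line against a factor of linear growth -/

/-- If `‖F(y)‖ ≤ C(1 + |y|)` and `F` is continuous then `y ↦ F(y) ĥ(c + iy)` is integrable for every
test function `h` (decay `|ĥ| ≤ D/(1+y²)²`, `norm_weilMellin_le_sq`). [folklore] -/
theorem integrable_mul_weilMellin_vertical_of_norm_le_linear {h : ℝ → ℂ} (hh : IsWeilTest h)
    (c : ℝ) {F : ℝ → ℂ} (hF : Continuous F) {C : ℝ} (hC : ∀ y, ‖F y‖ ≤ C * (1 + |y|)) :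
    Integrable fun y : ℝ ↦ F y * weilMellin h (c + y * I) := by
  set D := weilDecayW2 |c - 1 / 2| h with hD
  have hD0 : 0 ≤ D := weilDecayW2_nonneg _ _
  refine Integrable.mono' (integrable_inv_one_add_sq.const_mul (2 * |C| * D))
    (hF.mul (continuous_weilMellin_vertical hh.1.continuous hh.2 c)).aestronglyMeasurable
    (Eventually.of_forall fun y ↦ ?_)
  have hk : ‖weilMellin h (c + y * I)‖ ≤ D / (1 + y ^ 2) ^ 2 := by
    have := norm_weilMellin_le_sq hh (A := |c - 1 / 2|) (s := c + y * I) (by simp)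
    simpa [hD] using this
  have hFy : ‖F y‖ ≤ |C| * (1 + |y|) :=
    (hC y).trans (mul_le_mul_of_nonneg_right (le_abs_self C) (by positivity))
  have hy2 : 1 + |y| ≤ 2 * (1 + y ^ 2) := by
    rcases le_or_gt |y| 1 with h | h
    · nlinarith [sq_nonneg y]
    · have : |y| ≤ |y| ^ 2 := by nlinarith
      rw [sq_abs] at this; linarith
  have hpos : 0 < 1 + y ^ 2 := by positivity
  rw [norm_mul]
  calc ‖F y‖ * ‖weilMellin h (c + y * I)‖
      ≤ |C| * (1 + |y|) * (D / (1 + y ^ 2) ^ 2) :=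
        mul_le_mul hFy hk (norm_nonneg _) (by positivity)
    _ ≤ |C| * (2 * (1 + y ^ 2)) * (D / (1 + y ^ 2) ^ 2) := by gcongr
    _ = 2 * |C| * D * (1 + y ^ 2)⁻¹ := by field_simp

/-! ### The digamma series under the integral sign (Bombieri (2.5)) -/

/-- `Re((1/2 + iy)/2) = 1/4`. [folklore] -/
theorem re_half_line_div_two (y : ℝ) : ((((1 / 2 : ℝ) : ℂ) + y * I) / 2).re = 1 / 4 := by
  simp; norm_num

/-- **Term-by-term integration of the digamma series on the critical line** (Bombieri (2.5), in
absolutely convergent form): for a test function `k`, with `s = 1/2 + iy`, `w = s/2`,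
`Σₙ ∫ k̂(s)(1/(n+1) - 1/(w+n)) dy = ∫ k̂(s)(ψ(w) + γ) dy` (dominated convergence; the terms are
bounded by `4‖w-1‖‖k̂(s)‖/(n+1)²`). [cite: Bombieri2000Weil, §2 eq. (2.5)] -/
theorem hasSum_integral_weilMellin_mul_digammaSeries (hk : IsWeilTest k) :
    HasSum (fun n : ℕ ↦ ∫ y : ℝ, weilMellin k (((1 / 2 : ℝ) : ℂ) + y * I) *
        (1 / ((n : ℂ) + 1) - 1 / ((((1 / 2 : ℝ) : ℂ) + y * I) / 2 + n)))
      (∫ y : ℝ, weilMellin k (((1 / 2 : ℝ) : ℂ) + y * I) *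
        (digamma ((((1 / 2 : ℝ) : ℂ) + y * I) / 2) + Real.eulerMascheroniConstant)) := by
  have hw : ∀ y : ℝ, 0 < ((((1 / 2 : ℝ) : ℂ) + y * I) / 2).re := fun y ↦ by
    rw [re_half_line_div_two]; norm_num
  have hw4 : ∀ y : ℝ, min ((((1 / 2 : ℝ) : ℂ) + y * I) / 2).re 1 = 1 / 4 := fun y ↦ by
    rw [re_half_line_div_two]; norm_num
  have hne : ∀ (y : ℝ) (n : ℕ), (((1 / 2 : ℝ) : ℂ) + y * I) / 2 + n ≠ 0 := by
    intro y n h0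
    have h1 := congrArg Complex.re h0
    rw [add_re, re_half_line_div_two] at h1
    simp at h1
    have hn : (0 : ℝ) ≤ n := n.cast_nonneg
    linarith
  have hS : Summable fun n : ℕ ↦ 1 / ((n : ℝ) + 1) ^ 2 := by
    have h := (Real.summable_one_div_nat_pow.2 one_lt_two)
    exact_mod_cast (summable_nat_add_iff 1).2 h
  refine hasSum_integral_of_dominated_convergence
    (fun (n : ℕ) (y : ℝ) ↦ 4 * ‖(((1 / 2 : ℝ) : ℂ) + y * I) / 2 - 1‖ *
      ‖weilMellin k (((1 / 2 : ℝ) : ℂ) + y * I)‖ * (1 / ((n : ℝ) + 1) ^ 2))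
    (fun n ↦ ?_) (fun n ↦ Eventually.of_forall fun y ↦ ?_) (Eventually.of_forall fun y ↦ ?_) ?_
    (Eventually.of_forall fun y ↦ ?_)
  · -- measurability
    exact ((continuous_weilMellin_vertical hk.1.continuous hk.2 _).mul
      (continuous_const.sub (continuous_const.div (by fun_prop) fun y ↦ hne y n))).aestronglyMeasurable
  · -- the bound
    rw [norm_mul]
    have h := Literature.Analysis.SpecialFunctions.Complex.norm_one_div_sub_one_div_le (hw y) n
    rw [hw4 y] at h
    have hk0 := norm_nonneg (weilMellin k (((1 / 2 : ℝ) : ℂ) + y * I))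
    calc ‖weilMellin k (((1 / 2 : ℝ) : ℂ) + y * I)‖ *
          ‖1 / ((n : ℂ) + 1) - 1 / ((((1 / 2 : ℝ) : ℂ) + y * I) / 2 + n)‖
        ≤ ‖weilMellin k (((1 / 2 : ℝ) : ℂ) + y * I)‖ *
          (‖(((1 / 2 : ℝ) : ℂ) + y * I) / 2 - 1‖ / (1 / 4 * ((n : ℝ) + 1) ^ 2)) :=
          mul_le_mul_of_nonneg_left h hk0
      _ = 4 * ‖(((1 / 2 : ℝ) : ℂ) + y * I) / 2 - 1‖ *
          ‖weilMellin k (((1 / 2 : ℝ) : ℂ) + y * I)‖ * (1 / ((n : ℝ) + 1) ^ 2) := by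
          have : (0 : ℝ) < ((n : ℝ) + 1) ^ 2 := by positivity
          field_simp
  · -- summability of the bound
    exact hS.mul_left _
  · -- integrability of the summed bound
    simp_rw [tsum_mul_left]
    refine Integrable.mul_const ?_ _
    have hF : Continuous fun y : ℝ ↦ (4 : ℂ) * ((((1 / 2 : ℝ) : ℂ) + y * I) / 2 - 1) := by fun_prop
    have hI := integrable_mul_weilMellin_vertical_of_norm_le_linear hk (1 / 2) hF (C := 4)
      fun y ↦ ?_
    · refine hI.norm.congr (Eventually.of_forall fun y ↦ ?_)
      simp only [norm_mul]
      norm_num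
    · rw [norm_mul]
      have hre : ((((1 / 2 : ℝ) : ℂ) + y * I) / 2 - 1).re = -(3 / 4) := by
        rw [sub_re, re_half_line_div_two]; norm_num
      have him : ((((1 / 2 : ℝ) : ℂ) + y * I) / 2 - 1).im = y / 2 := by simp
      have h1 : ‖(((1 / 2 : ℝ) : ℂ) + y * I) / 2 - 1‖ ≤ 1 + |y| := by
        refine (Complex.norm_le_abs_re_add_abs_im _).trans ?_
        rw [hre, him]
        have ha : |(-(3 / 4) : ℝ)| = 3 / 4 := by norm_num
        have hb : |y / 2| = |y| / 2 := by rw [abs_div, abs_two]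
        rw [ha, hb]
        have := abs_nonneg y
        linarith
      have h4 : ‖(4 : ℂ)‖ = 4 := by norm_num
      rw [h4]
      exact mul_le_mul_of_nonneg_left h1 (by norm_num)
  · -- pointwise: the series of Andrews–Askey–Roy (1.2.13)
    exact (Literature.Analysis.SpecialFunctions.Complex.hasSum_one_div_sub_one_div_digamma
      (hw y)).mul_left _

/-- **The terms are polar integrals** (Bombieri (2.6)): for a test function `k` and `n ≥ 0`, with
`s = 1/2 + iy`, `w = s/2`, `1/(w + n) = 2/(s + 2n)` and
`∫ k̂(s)(1/(n+1) - 1/(w+n)) dy = 2π k(0)/(n+1) - 4π ∫₀^∞ k(x) e^{-(2n+1/2)x} dx`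
(`∫ k̂ = 2π k(0)` and the polar integral `∫ k̂(s)/(s + 2n) dy = 2π ∫₀^∞ k(x)e^{-(2n+1/2)x} dx`).
[cite: Bombieri2000Weil, §2 eq. (2.6)] -/
theorem integral_weilMellin_mul_digammaSeriesTerm (hk : IsWeilTest k) (n : ℕ) :
    ∫ y : ℝ, weilMellin k (((1 / 2 : ℝ) : ℂ) + y * I) *
        (1 / ((n : ℂ) + 1) - 1 / ((((1 / 2 : ℝ) : ℂ) + y * I) / 2 + n)) =
      2 * π * k 0 / ((n : ℂ) + 1) -
        4 * π * ∫ x in Ioi (0 : ℝ), k x * cexp ((-(2 * (n : ℂ)) - 1 / 2) * x) := by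
  have h1 : Integrable fun y : ℝ ↦ weilMellin k (((1 / 2 : ℝ) : ℂ) + y * I) :=
    integrable_weilMellin_vertical hk _
  have hre : (-(2 * (n : ℂ))).re < (1 / 2 : ℝ) := by
    have hn : (0 : ℝ) ≤ n := n.cast_nonneg
    simp; linarith
  have h2 := integral_weilMellin_vertical_div_sub hk (c := 1 / 2) (a := -(2 * (n : ℂ))) hre
  have h2i := integrable_weilMellin_vertical_div_sub hk (c := 1 / 2) (a := -(2 * (n : ℂ))) hre.ne
  have e : ∀ y : ℝ, weilMellin k (((1 / 2 : ℝ) : ℂ) + y * I) *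
      (1 / ((n : ℂ) + 1) - 1 / ((((1 / 2 : ℝ) : ℂ) + y * I) / 2 + n)) =
      1 / ((n : ℂ) + 1) * weilMellin k (((1 / 2 : ℝ) : ℂ) + y * I) -
        2 * (weilMellin k (((1 / 2 : ℝ) : ℂ) + y * I) /
          (((1 / 2 : ℝ) : ℂ) + y * I - -(2 * (n : ℂ)))) := by
    intro y
    have hne : (((1 / 2 : ℝ) : ℂ) + y * I) / 2 + n ≠ 0 := by
      intro h0
      have h1 := congrArg Complex.re h0
      rw [add_re, re_half_line_div_two] at h1
      simp at h1
      have hn : (0 : ℝ) ≤ n := n.cast_nonneg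
      linarith
    have hne' : ((1 / 2 : ℝ) : ℂ) + y * I - -(2 * (n : ℂ)) ≠ 0 := by
      intro h0
      have h1 := congrArg Complex.re h0
      simp at h1
      have hn : (0 : ℝ) ≤ n := n.cast_nonneg
      linarith
    have hn1 : (n : ℂ) + 1 ≠ 0 := by
      have : ((n + 1 : ℕ) : ℂ) ≠ 0 := Nat.cast_ne_zero.2 (Nat.succ_ne_zero n)
      simpa using this
    have key : 1 / ((((1 / 2 : ℝ) : ℂ) + y * I) / 2 + n) =
        2 / (((1 / 2 : ℝ) : ℂ) + y * I - -(2 * (n : ℂ))) := by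
      rw [div_eq_div_iff hne hne']
      ring
    rw [key]
    ring
  simp_rw [e]
  rw [integral_sub (h1.const_mul _) (h2i.const_mul 2), integral_const_mul, integral_const_mul,
    integral_weilMellin_vertical hk, h2]
  ring

/-- **The archimedean integral as a series** (Bombieri (2.5)–(2.7)): for a test function `g`,
`Σₙ (4π g(0)/(n+1) - 4π ∫₀^∞ (g(x) + g(-x)) e^{-(2n+1/2)x} dx) = 2·weilArchIntegral g + 4πγ g(0)`.
[cite: Bombieri2000Weil, §2 eq. (2.7)] -/
theorem hasSum_weilArchIntegral (hg : IsWeilTest g) :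
    HasSum (fun n : ℕ ↦ 4 * π * g 0 / ((n : ℂ) + 1) -
        4 * π * ∫ x in Ioi (0 : ℝ), (g x + g (-x)) * cexp ((-(2 * (n : ℂ)) - 1 / 2) * x))
      (2 * weilArchIntegral g + 4 * π * Real.eulerMascheroniConstant * g 0) := by
  have hk : IsWeilTest (weilSymm g) := hg.weilSymm
  -- the archimedean integral on the critical line against `k̂`
  have h0 : weilArchIntegral g = ∫ y : ℝ, 1 / 2 * digamma ((((1 / 2 : ℝ) : ℂ) + y * I) / 2) *
      weilMellin (weilSymm g) (((1 / 2 : ℝ) : ℂ) + y * I) := by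
    rw [← integral_digamma_mul_weilMellin_weilSymm hg, integral_digamma_half_mul_weilMellin_shift hk]
  have hIψ : Integrable fun y : ℝ ↦ weilMellin (weilSymm g) (((1 / 2 : ℝ) : ℂ) + y * I) *
      digamma ((((1 / 2 : ℝ) : ℂ) + y * I) / 2) := by
    have := (integrable_digamma_half_mul_weilMellin_vertical hk (c := 1 / 2) (by norm_num) 1
      (Or.inl rfl)).const_mul 2
    refine this.congr (Eventually.of_forall fun y ↦ ?_)
    simp only [one_mul]
    ring
  have hI1 : Integrable fun y : ℝ ↦ weilMellin (weilSymm g) (((1 / 2 : ℝ) : ℂ) + y * I) :=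
    integrable_weilMellin_vertical hk _
  have hsplit : (∫ y : ℝ, weilMellin (weilSymm g) (((1 / 2 : ℝ) : ℂ) + y * I) *
      (digamma ((((1 / 2 : ℝ) : ℂ) + y * I) / 2) + Real.eulerMascheroniConstant)) =
      2 * weilArchIntegral g + 4 * π * Real.eulerMascheroniConstant * g 0 := by
    have e : (fun y : ℝ ↦ weilMellin (weilSymm g) (((1 / 2 : ℝ) : ℂ) + y * I) *
        (digamma ((((1 / 2 : ℝ) : ℂ) + y * I) / 2) + Real.eulerMascheroniConstant)) =
        fun y : ℝ ↦ weilMellin (weilSymm g) (((1 / 2 : ℝ) : ℂ) + y * I) *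
          digamma ((((1 / 2 : ℝ) : ℂ) + y * I) / 2) +
          weilMellin (weilSymm g) (((1 / 2 : ℝ) : ℂ) + y * I) * Real.eulerMascheroniConstant := by
      funext y; ring
    rw [e, integral_add hIψ (hI1.mul_const _), integral_mul_const, integral_weilMellin_vertical hk,
      weilSymm_zero, h0, ← integral_const_mul]
    have e2 : (fun y : ℝ ↦ (2 : ℂ) * (1 / 2 * digamma ((((1 / 2 : ℝ) : ℂ) + y * I) / 2) *
        weilMellin (weilSymm g) (((1 / 2 : ℝ) : ℂ) + y * I))) =
        fun y : ℝ ↦ weilMellin (weilSymm g) (((1 / 2 : ℝ) : ℂ) + y * I) *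
          digamma ((((1 / 2 : ℝ) : ℂ) + y * I) / 2) := by
      funext y; ring
    rw [e2]
    ring
  have hA := hasSum_integral_weilMellin_mul_digammaSeries hk
  simp_rw [integral_weilMellin_mul_digammaSeriesTerm hk] at hA
  rw [hsplit, weilSymm_zero] at hA
  convert hA using 1
  funext n
  simp only [weilSymm]
  ring

/-! ### Bombieri's side: expanding `1/(2 sinh x)` (Bombieri (2.7)–(2.8)) -/

/-- `e^{-x}/(1 - e^{-2x}) = 1/(2 sinh x)` for `x > 0`. [folklore] -/
theorem exp_neg_div_one_sub_exp {x : ℝ} (hx : 0 < x) :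
    Real.exp (-x) / (1 - Real.exp (-(2 * x))) = 1 / (2 * Real.sinh x) := by
  rw [Real.sinh_eq]
  have h1 : Real.exp (-(2 * x)) = Real.exp (-x) * Real.exp (-x) := by
    rw [← Real.exp_add]; ring_nf
  have h2 : Real.exp x * Real.exp (-x) = 1 := by rw [← Real.exp_add]; simp
  have h3 : Real.exp (-x) < 1 := Real.exp_lt_one_iff.2 (by linarith)
  have h4 : 0 < Real.exp (-x) := Real.exp_pos _
  have h5 : Real.exp (-x) < Real.exp x := Real.exp_lt_exp.2 (by linarith)
  have hne1 : 1 - Real.exp (-x) * Real.exp (-x) ≠ 0 := by nlinarith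
  have hne2 : 2 * ((Real.exp x - Real.exp (-x)) / 2) ≠ 0 := by
    intro h; linarith
  rw [h1, div_eq_div_iff hne1 hne2, one_mul]
  linear_combination h2

/-- The numerator `h(x) = e^{x/2} k(x) - k(0)` of Bombieri's integrand is `O(x)` at `0`:
`‖h(x)‖ ≤ M x` on `[0, 1]` (mean value theorem; `k` is `C¹`). [folklore] -/
theorem exists_norm_bombieriNumerator_le_mul (hk : IsWeilTest k) :
    ∃ M : ℝ, 0 ≤ M ∧ ∀ x ∈ Icc (0 : ℝ) 1, ‖(Real.exp (x / 2) : ℂ) * k x - k 0‖ ≤ M * x := by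
  set h : ℝ → ℂ := fun x ↦ (Real.exp (x / 2) : ℂ) * k x with hh
  have he : ContDiff ℝ ∞ fun x : ℝ ↦ ((Real.exp (x / 2) : ℝ) : ℂ) := by
    have := Complex.ofRealCLM.contDiff.comp
      ((Real.contDiff_exp (n := ∞)).comp (contDiff_id.div_const (2 : ℝ)))
    simpa [Function.comp_def] using this
  have hd : ContDiff ℝ ∞ h := he.mul hk.1
  have hcont : Continuous (deriv h) := hd.continuous_deriv (by simp)
  obtain ⟨M, hM⟩ := (isCompact_Icc (a := (0 : ℝ)) (b := 1)).exists_bound_of_continuousOn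
    hcont.continuousOn
  have hM0 : 0 ≤ M := (norm_nonneg _).trans (hM 0 (left_mem_Icc.2 zero_le_one))
  refine ⟨M, hM0, fun x hx ↦ ?_⟩
  have hdiff : ∀ y ∈ Icc (0 : ℝ) 1, DifferentiableAt ℝ h y := fun y _ ↦
    (hd.differentiable (by simp)) y
  have hmv := (convex_Icc (0 : ℝ) 1).norm_image_sub_le_of_norm_deriv_le hdiff
    (fun y hy ↦ hM y hy) (left_mem_Icc.2 zero_le_one) hx
  have h0 : h 0 = k 0 := by simp [hh]
  rw [h0, sub_zero, Real.norm_eq_abs, abs_of_nonneg hx.1] at hmv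
  simpa [hh] using hmv

/-- **Bombieri's integrand is absolutely integrable**: `‖e^{x/2}k(x) - k(0)‖/(2 sinh x)` is
integrable on `(0, ∞)` for a test function `k` (it is bounded near `0` and `O(e^{-x/2})` at
infinity). [folklore] -/
theorem integrableOn_bombieriMajorant (hk : IsWeilTest k) :
    IntegrableOn (fun x : ℝ ↦ ‖(Real.exp (x / 2) : ℂ) * k x - k 0‖ / (2 * Real.sinh x))
      (Ioi 0) := by
  obtain ⟨M, hM0, hM⟩ := exists_norm_bombieriNumerator_le_mul hk
  obtain ⟨K, hK⟩ := hk.1.continuous.bounded_above_of_compact_support hk.2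
  have hK0 : 0 ≤ K := (norm_nonneg _).trans (hK 0)
  have hkc : Continuous k := hk.1.continuous
  set C : ℝ := M / 2 * Real.exp (1 / 2) + 4 * K with hC
  have hC0 : 0 ≤ C := by positivity
  refine Integrable.mono' ((exp_neg_integrableOn_Ioi 0 (by norm_num : (0 : ℝ) < 1 / 2)).const_mul C)
    ?_ ?_
  · refine (Measurable.div ?_ ?_).aestronglyMeasurable
    · exact (by fun_prop : Continuous fun x : ℝ ↦ ‖(Real.exp (x / 2) : ℂ) * k x - k 0‖).measurable
    · exact (by fun_prop : Continuous fun x : ℝ ↦ 2 * Real.sinh x).measurable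
  · refine (ae_restrict_iff' measurableSet_Ioi).2 (Eventually.of_forall fun x (hx : 0 < x) ↦ ?_)
    have hsinh : 0 < Real.sinh x := Real.sinh_pos_iff.2 hx
    have h2s : 0 < 2 * Real.sinh x := by positivity
    rw [Real.norm_eq_abs, abs_of_nonneg (div_nonneg (norm_nonneg _) h2s.le), div_le_iff₀ h2s]
    rcases le_or_gt x 1 with hx1 | hx1
    · -- near zero: `‖h(x)‖ ≤ M x ≤ M sinh x`
      have e1 : 1 ≤ Real.exp (1 / 2) * Real.exp (-(1 / 2) * x) := by
        rw [← Real.exp_add]; exact Real.one_le_exp (by linarith)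
      have e2 : x ≤ Real.sinh x := Real.self_le_sinh_iff.2 hx.le
      calc ‖(Real.exp (x / 2) : ℂ) * k x - k 0‖ ≤ M * x := hM x ⟨hx.le, hx1⟩
        _ ≤ M * Real.sinh x := by gcongr
        _ ≤ M * Real.sinh x * (Real.exp (1 / 2) * Real.exp (-(1 / 2) * x)) :=
            le_mul_of_one_le_right (by positivity) e1
        _ = M / 2 * Real.exp (1 / 2) * Real.exp (-(1 / 2) * x) * (2 * Real.sinh x) := by ring
        _ ≤ C * Real.exp (-(1 / 2) * x) * (2 * Real.sinh x) := by
            gcongr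
            rw [hC]
            linarith [mul_nonneg (by norm_num : (0 : ℝ) ≤ 4) hK0]
    · -- at infinity: `‖h(x)‖ ≤ K e^{x/2} + K`, `2 sinh x ≥ e^x/2`
      have hE1 : 1 ≤ Real.exp (x / 2) := Real.one_le_exp (by positivity)
      have hprod : Real.exp (-(1 / 2) * x) * Real.exp x = Real.exp (x / 2) := by
        rw [← Real.exp_add]; ring_nf
      have hex1 : Real.exp (-x) ≤ 1 := Real.exp_le_one_iff.2 (by linarith)
      have hex2 : (2 : ℝ) ≤ Real.exp x := by linarith [Real.add_one_le_exp x]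
      have h2s' : Real.exp x / 2 ≤ 2 * Real.sinh x := by rw [Real.sinh_eq]; linarith
      have hh : ‖(Real.exp (x / 2) : ℂ) * k x - k 0‖ ≤ Real.exp (x / 2) * K + K := by
        refine (norm_sub_le _ _).trans (add_le_add ?_ (hK 0))
        rw [norm_mul, Complex.norm_real, Real.norm_of_nonneg (Real.exp_pos _).le]
        exact mul_le_mul_of_nonneg_left (hK x) (Real.exp_pos _).le
      calc ‖(Real.exp (x / 2) : ℂ) * k x - k 0‖ ≤ Real.exp (x / 2) * K + K := hh
        _ ≤ 2 * K * Real.exp (x / 2) := by nlinarith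
        _ ≤ C / 2 * Real.exp (x / 2) := by
            gcongr
            rw [hC]
            nlinarith [Real.exp_pos (1 / 2)]
        _ = C * Real.exp (-(1 / 2) * x) * (Real.exp x / 2) := by rw [mul_assoc, ← hprod]; ring
        _ ≤ C * Real.exp (-(1 / 2) * x) * (2 * Real.sinh x) := by gcongr

/-- **Expansion of Bombieri's integral** (Bombieri (2.7)–(2.8)): for a test function `k`,
`Σₙ ∫₀^∞ (k(x) e^{-(2n+1/2)x} - k(0) e^{-(2n+1)x}) dx = ∫₀^∞ (e^{x/2} k(x) - k(0)) dx/(2 sinh x)`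
(`1/(2 sinh x) = Σₙ e^{-(2n+1)x}`, dominated convergence with the majorant
`‖e^{x/2}k(x) - k(0)‖/(2 sinh x)`). [cite: Bombieri2000Weil, §2 eq. (2.8)] -/
theorem hasSum_integral_bombieriTerms (hk : IsWeilTest k) :
    HasSum (fun n : ℕ ↦ ∫ x in Ioi (0 : ℝ),
        (k x * cexp ((-(2 * (n : ℂ)) - 1 / 2) * x) - k 0 * cexp (-(2 * (n : ℂ) + 1) * x)))
      (∫ x in Ioi (0 : ℝ), ((Real.exp (x / 2) : ℂ) * k x - k 0) / (2 * Real.sinh x : ℂ)) := by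
  have hkc : Continuous k := hk.1.continuous
  -- `F_n(x) = e^{-(2n+1)x} h(x)`
  have hF : ∀ (n : ℕ) (x : ℝ),
      k x * cexp ((-(2 * (n : ℂ)) - 1 / 2) * x) - k 0 * cexp (-(2 * (n : ℂ) + 1) * x) =
        cexp (-(2 * (n : ℂ) + 1) * x) * ((Real.exp (x / 2) : ℂ) * k x - k 0) := by
    intro n x
    have e1 : ((Real.exp (x / 2) : ℝ) : ℂ) = cexp ((x : ℂ) / 2) := by
      rw [Complex.ofReal_exp]; push_cast; ring_nf
    rw [e1, mul_sub, ← mul_assoc, ← Complex.exp_add]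
    have e2 : -(2 * (n : ℂ) + 1) * x + (x : ℂ) / 2 = (-(2 * (n : ℂ)) - 1 / 2) * x := by ring
    rw [e2]
    ring
  -- `e^{-(2n+1)x} = e^{-x} (e^{-2x})^n`, complex and real
  have hpowC : ∀ (n : ℕ) (x : ℝ), cexp (-(2 * (n : ℂ) + 1) * x) =
      cexp (-(x : ℂ)) * cexp (-(2 * (x : ℂ))) ^ n := by
    intro n x
    rw [← Complex.exp_nat_mul, ← Complex.exp_add]
    congr 1
    ring
  have hpowR : ∀ (n : ℕ) (x : ℝ), Real.exp (-(2 * (n : ℝ) + 1) * x) =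
      Real.exp (-x) * Real.exp (-(2 * x)) ^ n := by
    intro n x
    rw [← Real.exp_nat_mul, ← Real.exp_add]
    congr 1
    ring
  have hnormF : ∀ (n : ℕ) (x : ℝ), ‖cexp (-(2 * (n : ℂ) + 1) * x)‖ = Real.exp (-(2 * (n : ℝ) + 1) * x) := by
    intro n x
    have hcast : (-(2 * (n : ℂ) + 1) * (x : ℂ)) = ((-(2 * (n : ℝ) + 1) * x : ℝ) : ℂ) := by
      push_cast; ring
    rw [hcast, Complex.norm_exp, Complex.ofReal_re]
  simp_rw [hF]
  refine hasSum_integral_of_dominated_convergence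
    (fun (n : ℕ) (x : ℝ) ↦ Real.exp (-(2 * (n : ℝ) + 1) * x) * ‖(Real.exp (x / 2) : ℂ) * k x - k 0‖)
    (fun n ↦ ?_) (fun n ↦ Eventually.of_forall fun x ↦ ?_) ?_ ?_ ?_
  · exact (by fun_prop : Continuous fun x : ℝ ↦ cexp (-(2 * (n : ℂ) + 1) * x) *
      ((Real.exp (x / 2) : ℂ) * k x - k 0)).aestronglyMeasurable
  · rw [norm_mul, hnormF]
  · refine (ae_restrict_iff' measurableSet_Ioi).2 (Eventually.of_forall fun x (hx : 0 < x) ↦ ?_)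
    have h0 : 0 ≤ Real.exp (-(2 * x)) := (Real.exp_pos _).le
    have h1 : Real.exp (-(2 * x)) < 1 := Real.exp_lt_one_iff.2 (by linarith)
    have e : (fun n : ℕ ↦ Real.exp (-(2 * (n : ℝ) + 1) * x) * ‖(Real.exp (x / 2) : ℂ) * k x - k 0‖) =
        fun n : ℕ ↦ Real.exp (-x) * ‖(Real.exp (x / 2) : ℂ) * k x - k 0‖ * Real.exp (-(2 * x)) ^ n := by
      funext n; rw [hpowR]; ring
    rw [e]
    exact (summable_geometric_of_lt_one h0 h1).mul_left _
  · refine ((integrableOn_bombieriMajorant hk).congr_fun (fun x (hx : 0 < x) ↦ ?_)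
      measurableSet_Ioi).integrable
    have h0 : 0 ≤ Real.exp (-(2 * x)) := (Real.exp_pos _).le
    have h1 : Real.exp (-(2 * x)) < 1 := Real.exp_lt_one_iff.2 (by linarith)
    have e : (fun n : ℕ ↦ Real.exp (-(2 * (n : ℝ) + 1) * x) * ‖(Real.exp (x / 2) : ℂ) * k x - k 0‖) =
        fun n : ℕ ↦ Real.exp (-x) * ‖(Real.exp (x / 2) : ℂ) * k x - k 0‖ * Real.exp (-(2 * x)) ^ n := by
      funext n; rw [hpowR]; ring
    show ‖(Real.exp (x / 2) : ℂ) * k x - k 0‖ / (2 * Real.sinh x) =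
      ∑' n : ℕ, Real.exp (-(2 * (n : ℝ) + 1) * x) * ‖(Real.exp (x / 2) : ℂ) * k x - k 0‖
    rw [e, tsum_mul_left, tsum_geometric_of_lt_one h0 h1, div_eq_mul_one_div,
      ← exp_neg_div_one_sub_exp hx]
    ring
  · refine (ae_restrict_iff' measurableSet_Ioi).2 (Eventually.of_forall fun x (hx : 0 < x) ↦ ?_)
    have hr : ‖cexp (-(2 * (x : ℂ)))‖ < 1 := by
      have hcast : (-(2 * (x : ℂ))) = ((-(2 * x) : ℝ) : ℂ) := by push_cast; ring
      rw [hcast, Complex.norm_exp, Complex.ofReal_re]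
      exact Real.exp_lt_one_iff.2 (by linarith)
    have hgeo := (hasSum_geometric_of_norm_lt_one hr).mul_left
      (cexp (-(x : ℂ)) * ((Real.exp (x / 2) : ℂ) * k x - k 0))
    have hC : cexp (-(x : ℂ)) / (1 - cexp (-(2 * (x : ℂ)))) = 1 / (2 * (Real.sinh x : ℂ)) := by
      have := congrArg (fun r : ℝ ↦ (r : ℂ)) (exp_neg_div_one_sub_exp hx)
      push_cast at this
      rw [Complex.ofReal_sinh]
      exact this
    have ef : (fun n : ℕ ↦ cexp (-(2 * (n : ℂ) + 1) * x) * ((Real.exp (x / 2) : ℂ) * k x - k 0)) =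
        fun n : ℕ ↦ cexp (-(x : ℂ)) * ((Real.exp (x / 2) : ℂ) * k x - k 0) *
          cexp (-(2 * (x : ℂ))) ^ n := by
      funext n
      rw [hpowC]
      ring
    have ev : ((Real.exp (x / 2) : ℂ) * k x - k 0) / (2 * (Real.sinh x : ℂ)) =
        cexp (-(x : ℂ)) * ((Real.exp (x / 2) : ℂ) * k x - k 0) * (1 - cexp (-(2 * (x : ℂ))))⁻¹ := by
      calc ((Real.exp (x / 2) : ℂ) * k x - k 0) / (2 * (Real.sinh x : ℂ))
          = ((Real.exp (x / 2) : ℂ) * k x - k 0) * (1 / (2 * (Real.sinh x : ℂ))) := by ring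
        _ = ((Real.exp (x / 2) : ℂ) * k x - k 0) *
            (cexp (-(x : ℂ)) / (1 - cexp (-(2 * (x : ℂ))))) := by rw [hC]
        _ = _ := by ring
    rw [ef, ev]
    exact hgeo

/-- The terms of Bombieri's expansion:
`∫₀^∞ (k(x) e^{-(2n+1/2)x} - k(0) e^{-(2n+1)x}) dx = ∫₀^∞ k(x)e^{-(2n+1/2)x} dx - k(0)/(2n+1)`.
[folklore] -/
theorem integral_bombieriTerm (hk : IsWeilTest k) (n : ℕ) :
    ∫ x in Ioi (0 : ℝ),
        (k x * cexp ((-(2 * (n : ℂ)) - 1 / 2) * x) - k 0 * cexp (-(2 * (n : ℂ) + 1) * x)) =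
      (∫ x in Ioi (0 : ℝ), k x * cexp ((-(2 * (n : ℂ)) - 1 / 2) * x)) - k 0 / (2 * (n : ℂ) + 1) := by
  have hn : (0 : ℝ) ≤ n := n.cast_nonneg
  have ha : (-(2 * (n : ℂ) + 1)).re < 0 := by simp; linarith
  have hi1 : IntegrableOn (fun x : ℝ ↦ k x * cexp ((-(2 * (n : ℂ)) - 1 / 2) * x)) (Ioi 0) :=
    ((hk.1.continuous.mul (by fun_prop)).integrable_of_hasCompactSupport hk.2.mul_right).integrableOn
  have hi2 : IntegrableOn (fun x : ℝ ↦ k 0 * cexp (-(2 * (n : ℂ) + 1) * x)) (Ioi 0) :=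
    (integrableOn_exp_mul_complex_Ioi ha 0).const_mul _
  rw [integral_sub hi1 hi2, integral_const_mul, integral_exp_mul_complex_Ioi ha 0]
  congr 1
  rw [Complex.ofReal_zero, mul_zero, Complex.exp_zero, neg_div_neg_eq, mul_one_div]

/-! ### `log 4` -/

/-- `Σₙ (2/(2n+1) - 1/(n+1)) = log 4` (the series of Andrews–Askey–Roy (1.2.13) at `w = 1/2`,
`ψ(1/2) = -2 log 2 - γ`; this is the `log 4` of Bombieri (2.8)). [folklore] -/
theorem hasSum_two_div_sub_one_div :
    HasSum (fun n : ℕ ↦ 2 / (2 * (n : ℂ) + 1) - 1 / ((n : ℂ) + 1)) ((Real.log 4 : ℝ) : ℂ) := by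
  have h := Literature.Analysis.SpecialFunctions.Complex.hasSum_one_div_sub_one_div_digamma
    (w := (1 / 2 : ℂ)) (by norm_num)
  rw [Complex.digamma_one_half] at h
  have hlog : ((Real.log 4 : ℝ) : ℂ) = 2 * Complex.log 2 := by
    rw [show (4 : ℝ) = 2 ^ 2 by norm_num, Real.log_pow]
    push_cast
    rw [Complex.ofReal_log (by norm_num)]
    push_cast
    ring
  rw [hlog]
  have ef : (fun n : ℕ ↦ 2 / (2 * (n : ℂ) + 1) - 1 / ((n : ℂ) + 1)) =
      fun n : ℕ ↦ -(1 / ((n : ℂ) + 1) - 1 / (1 / 2 + (n : ℂ))) := by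
    funext n
    have h1 : (2 * (n : ℂ) + 1) ≠ 0 := by
      have : ((2 * n + 1 : ℕ) : ℂ) ≠ 0 := Nat.cast_ne_zero.2 (by omega)
      simpa using this
    have h3 : (1 / 2 + (n : ℂ)) ≠ 0 := by
      intro h0
      apply h1
      linear_combination 2 * h0
    have key : (2 : ℂ) / (2 * (n : ℂ) + 1) = 1 / (1 / 2 + (n : ℂ)) := by
      rw [div_eq_div_iff h1 h3]; ring
    rw [key]
    ring
  have ev : (2 * Complex.log 2) =
      -(-2 * Complex.log 2 - Real.eulerMascheroniConstant + Real.eulerMascheroniConstant) := by ring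
  rw [ef, ev]
  exact h.neg

/-! ### The identity -/

/-- **Bombieri 2000, §2, eq. (2.8)** (the "Moreover" clause of the Explicit Formula), transported
by `x = e^t`: for every test function `g`,
`-(log 4π + γ) g(0) - ∫₀^∞ (e^{t/2}(g(t)+g(-t)) - 2g(0)) dt/(2 sinh t)
  = (1/2π) ∫ ĝ(1/2+it) Re ψ(1/4+it/2) dt - g(0) log π`,
i.e. `weilArchTermBombieri g = weilArchTerm g`. [cite: Bombieri2000Weil, §2 eq. (2.8)] -/
theorem weilArchTermBombieri_eq_weilArchTerm_holds : weilArchTermBombieri_eq_weilArchTerm := by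
  intro g hg
  have hk : IsWeilTest (weilSymm g) := hg.weilSymm
  -- (I) the archimedean integral as a series
  have h1 := hasSum_weilArchIntegral hg
  -- (II) Bombieri's integral as a series
  have h2 := hasSum_integral_bombieriTerms hk
  simp_rw [integral_bombieriTerm hk] at h2
  simp only [weilSymm_zero] at h2
  simp only [weilSymm] at h2
  -- (III) `log 4`
  have h3 := hasSum_two_div_sub_one_div
  -- combine: the series `h1 + 4π h2 + 4π g(0) h3` vanishes termwise
  have hsum := (h1.add (h2.mul_left (4 * π : ℂ))).add (h3.mul_left (4 * π * g 0 : ℂ))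
  have hV := (show HasSum (fun _ : ℕ ↦ (0 : ℂ)) _ by
    convert hsum using 1
    funext n
    ring).unique hasSum_zero
  -- `hV : 2 W + 4πγ g(0) + 4π B + 4π g(0) log 4 = 0`
  have hW : weilArchIntegral g = 2 * π * (-(Real.eulerMascheroniConstant * g 0) -
      (∫ x in Ioi (0 : ℝ), ((Real.exp (x / 2) : ℂ) * (g x + g (-x)) - 2 * g 0) /
        (2 * Real.sinh x : ℂ)) - g 0 * ((Real.log 4 : ℝ) : ℂ)) := by
    linear_combination (1 / 2 : ℂ) * hV
  have hπ : (π : ℂ) ≠ 0 := Complex.ofReal_ne_zero.2 Real.pi_ne_zero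
  rw [weilArchTermBombieri_eq]
  unfold weilArchTerm
  rw [hW, Real.log_mul (by norm_num) Real.pi_ne_zero, Complex.ofReal_add]
  field_simp
  ring

end Literature.NumberTheory.LFunctions

end
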